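import Mathlib.Algebra.Category.ModuleCat.Ext.Finite
import Mathlib.Algebra.Homology.DerivedCategory.Ext.Map
import Mathlib.Algebra.Homology.DerivedCategory.Ext.MapBijective
import Mathlib.Algebra.Category.ModuleCat.ChangeOfRings
import Mathlib.CategoryTheory.Preadditive.Projective.Preserves
import Mathlib.RingTheory.Localization.Basic
import Mathlib.Algebra.Module.FinitePresentation
import Mathlib.RingTheory.LocalProperties.ProjectiveDimension
import Mathlib.RingTheory.Localization.Finiteness
import Literature.RingTheory.CohomologyAnnihilator.Basic
import HarnessLib

/-!
# Cohomology annihilators and localisation (Iyengar–Takahashi, Lemma 2.10(1))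

Topic: `Literature/RingTheory/CohomologyAnnihilator`.

For a commutative noetherian ring `R` and a multiplicatively closed subset `U ⊆ R`,
[IyengarTakahashi2014, Lemma 2.10(1)] states the inclusions
`U⁻¹ caⁿ(R) ⊆ caⁿ(U⁻¹R)` and `U⁻¹ ca(R) ⊆ ca(U⁻¹R)`.
We PROVE them (`map_cohomologyAnnihilatorOfDegree_le`, `map_cohomologyAnnihilator_le`, and for
any `IsLocalization U R'` algebra `…_of_isLocalization`), following the printed proof: "each
finitely generated module over `U⁻¹Λ` has the form `U⁻¹M` for some `M ∈ mod Λ`"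
(`exists_iso_localizedModule`) and "`U⁻¹Extⁿ_Λ(M, N) ≅ Extⁿ_{U⁻¹Λ}(U⁻¹M, U⁻¹N)`", of which only
the surjectivity half is needed and proved (`span_range_extLocalizationMap_eq_top`: the
`U⁻¹R`-module `Extⁿ_{U⁻¹R}(U⁻¹M, U⁻¹N)` is spanned by the image of `Extⁿ_R(M, N)`), by dimension
shifting along a finite presentation of `M` — in degree `0` this is
`Hom_{U⁻¹R}(U⁻¹M, U⁻¹N) ≅ U⁻¹Hom_R(M, N)` for finitely presented `M`
(Mathlib's `Module.FinitePresentation.isLocalizedModule_mapExtendScalars`).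

The comparison map is Mathlib's `CategoryTheory.Abelian.Ext.mapExactFunctor` for the exact functor
`ModuleCat.localizedModuleFunctor U : ModuleCat R ⥤ ModuleCat (Localization U)`, packaged as
`extLocalizationMap U M N i` (target `Ext (M.localizedModule U) (N.localizedModule U) i`) with its
compatibility with `mk₀`, composition, connecting classes and the scalar actions
(`extLocalizationMap_smul`: `x • e ↦ (x/1) • e`). The passage from `Localization U` to an arbitrary
`IsLocalization U R'` uses the invariance of `caⁿ` under ring isomorphisms
(`map_ringEquiv_cohomologyAnnihilatorOfDegree`, via Mathlib's bijectivity of `Ext.mapExactFunctor`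
for the restriction-of-scalars equivalence).
-/

noncomputable section

open CategoryTheory CategoryTheory.Abelian

universe u

namespace Literature.RingTheory.CohomologyAnnihilator

variable {R : Type u} [CommRing R] (U : Submonoid R)

/-! ## The comparison map `Extⁱ_R(M, N) → Extⁱ_{U⁻¹R}(U⁻¹M, U⁻¹N)` -/

/-- The comparison map `Extⁱ_R(M, N) → Extⁱ_{U⁻¹R}(U⁻¹M, U⁻¹N)` induced by the exact localisation
functor `ModuleCat.localizedModuleFunctor U` (Mathlib's `Ext.mapExactFunctor`, with its target
spelled `Ext (M.localizedModule U) (N.localizedModule U) i`). [folklore] -/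
def extLocalizationMap (M N : ModuleCat.{u} R) (i : ℕ) :
    Ext.{u} M N i → Ext.{u} (M.localizedModule U) (N.localizedModule U) i :=
  Ext.mapExactFunctor (ModuleCat.localizedModuleFunctor.{u} U)

variable {U}

/-- The comparison map sends `0` to `0`. [folklore] -/
theorem extLocalizationMap_zero {M N : ModuleCat.{u} R} {i : ℕ} :
    extLocalizationMap U M N i 0 = 0 :=
  Ext.mapExactFunctor_zero _ _ _ _

/-- The comparison map on `Ext⁰ = Hom` is localisation of linear maps. [folklore] -/
theorem extLocalizationMap_mk₀ {M N : ModuleCat.{u} R} (f : M ⟶ N) :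
    extLocalizationMap U M N 0 (Ext.mk₀ f) = Ext.mk₀ (ModuleCat.localizedModuleMap U f) :=
  Ext.mapExactFunctor_mk₀ _ f

/-- The comparison map is compatible with the composition (Yoneda product) of `Ext`.
[folklore] -/
theorem extLocalizationMap_comp {M N P : ModuleCat.{u} R} {a b c : ℕ} (α : Ext.{u} M N a)
    (β : Ext.{u} N P b) (h : a + b = c) :
    extLocalizationMap U M P c (α.comp β h) =
      (extLocalizationMap U M N a α).comp (extLocalizationMap U N P b β) h :=
  Ext.mapExactFunctor_comp _ α β h

/-- The comparison map sends the class of a short exact sequence `S` to the class of the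
(exact) localised sequence `U⁻¹S`. [folklore] -/
theorem extLocalizationMap_extClass {S : ShortComplex (ModuleCat.{u} R)} (hS : S.ShortExact) :
    extLocalizationMap U S.X₃ S.X₁ 1 hS.extClass =
      (hS.map_of_exact (ModuleCat.localizedModuleFunctor.{u} U)).extClass :=
  Ext.mapExactFunctor_extClass _ hS

/-- Naturality of the comparison map with respect to the connecting maps
`Extⁱ(S.X₁, N) → Extⁱ⁺¹(S.X₃, N)` of a short exact sequence `S` and of `U⁻¹S`. [folklore] -/
theorem extLocalizationMap_extClass_comp {S : ShortComplex (ModuleCat.{u} R)} (hS : S.ShortExact)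
    (N : ModuleCat.{u} R) {i : ℕ} (e : Ext.{u} S.X₁ N i) :
    extLocalizationMap U S.X₃ N (i + 1) (hS.extClass.comp e (add_comm 1 i)) =
      (hS.map_of_exact (ModuleCat.localizedModuleFunctor.{u} U)).extClass.comp
        (extLocalizationMap U S.X₁ N i e) (add_comm 1 i) := by
  rw [extLocalizationMap_comp, extLocalizationMap_extClass]
  rfl

/-- The localisation functor sends the homothety `x • 𝟙_N` to the homothety `(x/1) • 𝟙_{U⁻¹N}`.
[folklore] -/
theorem localizedModuleMap_smul_id (N : ModuleCat.{u} R) (x : R) :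
    ModuleCat.localizedModuleMap U (x • 𝟙 N) =
      algebraMap R (Localization U) x • 𝟙 (N.localizedModule U) := by
  apply ModuleCat.hom_ext
  apply LinearMap.restrictScalars_injective R
  apply IsLocalizedModule.linearMap_ext U (N.localizedModuleMkLinearMap U)
    (N.localizedModuleMkLinearMap U)
  ext n
  simp [algebraMap_smul]

/-- The comparison map intertwines the `R`-action on `Extⁱ_R(M, N)` with the `U⁻¹R`-action on
`Extⁱ_{U⁻¹R}(U⁻¹M, U⁻¹N)`: `x • e ↦ (x/1) • e` (both actions are composition with a homothety,
`Ext.smul_eq_comp_mk₀`). [folklore] -/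
theorem extLocalizationMap_smul {M N : ModuleCat.{u} R} {i : ℕ} (x : R) (e : Ext.{u} M N i) :
    extLocalizationMap U M N i (x • e) =
      algebraMap R (Localization U) x • extLocalizationMap U M N i e := by
  rw [Ext.smul_eq_comp_mk₀, extLocalizationMap_comp, extLocalizationMap_mk₀, Ext.smul_eq_comp_mk₀,
    localizedModuleMap_smul_id]

/-! ## Finitely generated `U⁻¹R`-modules come from finitely generated `R`-modules -/

variable (U)

/-- An `R`-submodule `M₀` of a `U⁻¹R`-module `N` which generates `N` over `U⁻¹R` exhibits `N` as
the localisation `U⁻¹M₀` (via the inclusion). [folklore] -/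
theorem isLocalizedModule_subtype_of_span_eq_top {N : Type u} [AddCommGroup N] [Module R N]
    [Module (Localization U) N] [IsScalarTower R (Localization U) N] (M₀ : Submodule R N)
    (h : Submodule.span (Localization U) (M₀ : Set N) = ⊤) :
    IsLocalizedModule U M₀.subtype where
  map_units u := (isLocalizedModule_id U N (Localization U)).map_units u
  surj y := by
    obtain ⟨t, ht⟩ := multiple_mem_span_of_mem_localization_span U (Localization U) (M₀ : Set N) y
      (by rw [h]; exact Submodule.mem_top)
    rw [Submodule.span_eq] at ht
    exact ⟨⟨⟨t • y, ht⟩, t⟩, rfl⟩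
  exists_of_eq h := ⟨1, by simpa using Subtype.ext h⟩

/-- "Each finitely generated module over `U⁻¹Λ` has the form `U⁻¹M` for some `M ∈ mod Λ`": every
finitely generated `U⁻¹R`-module is isomorphic, in `ModuleCat (Localization U)`, to the
localisation of a finitely generated `R`-module (the `R`-span of a finite generating set).
[cite: IyengarTakahashi2014, Lemma 2.10 (proof)] -/
theorem exists_iso_localizedModule (N : Type u) [AddCommGroup N] [Module R N]
    [Module (Localization U) N] [IsScalarTower R (Localization U) N]
    [Module.Finite (Localization U) N] :
    ∃ (M : ModuleCat.{u} R), Module.Finite R M ∧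
      Nonempty ((ModuleCat.localizedModuleFunctor.{u} U).obj M ≅ ModuleCat.of (Localization U) N) := by
  classical
  obtain ⟨s, hs⟩ := Module.Finite.fg_top (R := Localization U) (M := N)
  let M₀ : Submodule R N := Submodule.span R (s : Set N)
  have hM₀ : Module.Finite R M₀ := Module.Finite.iff_fg.mpr (Submodule.fg_span s.finite_toSet)
  have hloc : IsLocalizedModule U M₀.subtype :=
    isLocalizedModule_subtype_of_span_eq_top U M₀ (by
      rw [← hs]; exact Submodule.span_span_of_tower R (Localization U) (s : Set N))
  let M : ModuleCat.{u} R := ModuleCat.of R M₀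
  have : IsLocalizedModule U (M.localizedModuleMkLinearMap U) :=
    ModuleCat.localizedModule_isLocalizedModule M U
  let e₁ := IsLocalizedModule.linearEquiv U (M.localizedModuleMkLinearMap U) M₀.subtype
  let e₂ := LinearEquiv.extendScalarsOfIsLocalization U (Localization U) e₁
  exact ⟨M, hM₀, ⟨e₂.toModuleIso⟩⟩

/-! ## `Extⁱ_{U⁻¹R}(U⁻¹M, U⁻¹N)` is generated by the image of `Extⁱ_R(M, N)` -/

/-- Surjectivity half of "`U⁻¹Extⁱ_R(M, N) ≅ Extⁱ_{U⁻¹R}(U⁻¹M, U⁻¹N)` for `M` finitely generated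
over a noetherian ring": the `U⁻¹R`-module `Extⁱ_{U⁻¹R}(U⁻¹M, U⁻¹N)` is spanned by the image of
the comparison map. Proof by dimension shifting: in degree `0` this is
`Hom_{U⁻¹R}(U⁻¹M, U⁻¹N) = U⁻¹Hom_R(M, N)` for finitely presented `M`; in degree `i + 1` use a
presentation `0 → K → P → M → 0` with `P` finite free, the `U⁻¹R`-linear surjection
`Extⁱ(U⁻¹K, U⁻¹N) ↠ Extⁱ⁺¹(U⁻¹M, U⁻¹N)` (as `U⁻¹P` is projective) and naturality of the comparison
maps with respect to the connecting maps. [cite: IyengarTakahashi2014, Lemma 2.10 (proof)] -/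
theorem span_range_extLocalizationMap_eq_top [IsNoetherianRing R] (i : ℕ) :
    ∀ (M N : ModuleCat.{u} R), Module.Finite R M →
      Submodule.span (Localization U) (Set.range (extLocalizationMap U M N i)) = ⊤ := by
  induction i with
  | zero =>
    intro M N hM
    rw [eq_top_iff]
    rintro e' -
    obtain ⟨g, rfl⟩ := (Ext.mk₀_bijective _ _).2 e'
    have : Module.FinitePresentation R M := Module.finitePresentation_of_finite R M
    obtain ⟨⟨f, s⟩, hfs⟩ := IsLocalizedModule.surj U
      (IsLocalizedModule.mapExtendScalars U (M.localizedModuleMkLinearMap U)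
        (N.localizedModuleMkLinearMap U) (Localization U)) g.hom
    have hunit := IsLocalization.map_units (Localization U) s
    have key : algebraMap R (Localization U) s • Ext.mk₀ g =
        extLocalizationMap U M N 0 (Ext.mk₀ (ModuleCat.ofHom f)) := by
      rw [extLocalizationMap_mk₀, ← Ext.mk₀_smul]
      congr 1
      apply ModuleCat.hom_ext
      change algebraMap R (Localization U) s • g.hom =
        IsLocalizedModule.mapExtendScalars U (M.localizedModuleMkLinearMap U)
          (N.localizedModuleMkLinearMap U) (Localization U) f
      rw [← hfs]
      ext m
      simp [LinearMap.smul_apply, Submonoid.smul_def, algebraMap_smul]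
    have : Ext.mk₀ g = (hunit.unit⁻¹ : (Localization U)ˣ) •
        (algebraMap R (Localization U) s • Ext.mk₀ g) := by
      rw [Units.smul_def, smul_smul, IsUnit.val_inv_mul, one_smul]
    rw [this, key]
    exact Submodule.smul_mem _ _ (Submodule.subset_span ⟨_, rfl⟩)
  | succ i ih =>
    intro M N hM
    obtain ⟨P, _, _, _, _, f, surjf⟩ := Module.exists_finite_presentation R M
    have hS := LinearMap.shortExact_shortComplexKer surjf
    have : Module.Finite R (LinearMap.ker f) := Module.IsNoetherian.finite R _
    have hFS := hS.map_of_exact (ModuleCat.localizedModuleFunctor.{u} U)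
    have proj := ModuleCat.projective_of_categoryTheory_projective f.shortComplexKer.X₂
    have : Projective (f.shortComplexKer.map (ModuleCat.localizedModuleFunctor.{u} U)).X₂ :=
      (ModuleCat.localizedModuleFunctor.{u} U).projective_obj_of_projective proj
    have surj := precomp_extClass_surjective_of_projective_X₂ (N.localizedModule U) hFS i
    rw [eq_top_iff]
    rintro e' -
    obtain ⟨g', rfl⟩ := surj e'
    have hg' : g' ∈ Submodule.span (Localization U)
        (Set.range (extLocalizationMap U (ModuleCat.of R (LinearMap.ker f)) N i)) := by
      rw [ih (ModuleCat.of R (LinearMap.ker f)) N inferInstance]; trivial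
    let δ' := hFS.extClass.precompOfLinear (Localization U) (N.localizedModule U) (add_comm 1 i)
    have hle : Submodule.span (Localization U)
        (Set.range (extLocalizationMap U (ModuleCat.of R (LinearMap.ker f)) N i)) ≤
        (Submodule.span (Localization U)
          (Set.range (extLocalizationMap U M N (i + 1)))).comap δ' := by
      rw [Submodule.span_le]
      rintro _ ⟨e, rfl⟩
      exact Submodule.subset_span ⟨hS.extClass.precomp N (add_comm 1 i) e,
        extLocalizationMap_extClass_comp hS N e⟩
    exact hle hg'

/-! ## Lemma 2.10(1) -/

/-- Transport of annihilation along isomorphisms in both arguments of `Ext` (in any linear abelian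
category): if `r` kills `Extⁿ(X, Y)` and `X ≅ X'`, `Y ≅ Y'` then `r` kills `Extⁿ(X', Y')`.
[folklore] -/
theorem ext_smul_eq_zero_of_iso {C : Type*} [Category C] [Abelian C] [HasExt.{u} C] {S : Type*}
    [Ring S] [Linear S C] {X X' Y Y' : C} (α : X ≅ X') (β : Y ≅ Y') (r : S) {n : ℕ}
    (h : ∀ e : Ext X Y n, r • e = 0) (e' : Ext X' Y' n) : r • e' = 0 := by
  have key := h ((Ext.mk₀ α.hom).comp (e'.comp (Ext.mk₀ β.inv) (add_zero n)) (zero_add n))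
  have he' : e' = (Ext.mk₀ α.inv).comp
      (((Ext.mk₀ α.hom).comp (e'.comp (Ext.mk₀ β.inv) (add_zero n)) (zero_add n)).comp
        (Ext.mk₀ β.hom) (add_zero n)) (zero_add n) := by
    simp
  rw [he', ← Ext.comp_smul, ← Ext.smul_comp, key, Ext.zero_comp, Ext.comp_zero]

/-- **Lemma 2.10(1)**, elementwise: if `x ∈ caⁿ(R)` then `x/1 ∈ caⁿ(U⁻¹R)` (noetherian `R`).
Proof as printed: a pair of finitely generated `U⁻¹R`-modules is `(U⁻¹M, U⁻¹N)` with `M`, `N`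
finitely generated over `R`, and `Extⁱ_{U⁻¹R}(U⁻¹M, U⁻¹N)` is generated by the image of
`Extⁱ_R(M, N)`, on which `x/1` acts as `x`, i.e. by `0` for `i ≥ n`.
[cite: IyengarTakahashi2014, Lemma 2.10(1)] -/
theorem algebraMap_mem_cohomologyAnnihilatorOfDegree [IsNoetherianRing R] {n : ℕ} {x : R}
    (hx : x ∈ cohomologyAnnihilatorOfDegree R n) :
    algebraMap R (Localization U) x ∈ cohomologyAnnihilatorOfDegree (Localization U) n := by
  rw [mem_cohomologyAnnihilatorOfDegree_iff]
  intro i hi M' N' hM' hN' e'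
  letI : Module R M' := Module.compHom M' (algebraMap R (Localization U))
  haveI : IsScalarTower R (Localization U) M' := IsScalarTower.of_algebraMap_smul fun _ _ => rfl
  letI : Module R N' := Module.compHom N' (algebraMap R (Localization U))
  haveI : IsScalarTower R (Localization U) N' := IsScalarTower.of_algebraMap_smul fun _ _ => rfl
  obtain ⟨M, hM, ⟨α⟩⟩ := exists_iso_localizedModule U M'
  obtain ⟨N, hN, ⟨β⟩⟩ := exists_iso_localizedModule U N'
  refine ext_smul_eq_zero_of_iso α β _ (fun e => ?_) e'
  have hmem : e ∈ Submodule.span (Localization U) (Set.range (extLocalizationMap U M N i)) := by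
    rw [span_range_extLocalizationMap_eq_top U i M N hM]; trivial
  have hle : Submodule.span (Localization U) (Set.range (extLocalizationMap U M N i)) ≤
      Submodule.torsionBy (Localization U) _ (algebraMap R (Localization U) x) := by
    rw [Submodule.span_le]
    rintro _ ⟨e₀, rfl⟩
    simp only [SetLike.mem_coe, Submodule.mem_torsionBy_iff]
    rw [← extLocalizationMap_smul, smul_eq_zero_of_mem_cohomologyAnnihilatorOfDegree hx hi,
      extLocalizationMap_zero]
  exact (Submodule.mem_torsionBy_iff _ _).mp (hle hmem)

/-- **Lemma 2.10(1)**: `U⁻¹ caⁿ(R) ⊆ caⁿ(U⁻¹R)`, i.e. the extension of `caⁿ(R)` to the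
localisation `U⁻¹R = Localization U` is contained in `caⁿ(U⁻¹R)` (noetherian `R`).
[cite: IyengarTakahashi2014, Lemma 2.10(1)] -/
theorem map_cohomologyAnnihilatorOfDegree_le [IsNoetherianRing R] (n : ℕ) :
    (cohomologyAnnihilatorOfDegree R n).map (algebraMap R (Localization U)) ≤
      cohomologyAnnihilatorOfDegree (Localization U) n :=
  Ideal.map_le_iff_le_comap.mpr fun _ hx => algebraMap_mem_cohomologyAnnihilatorOfDegree U hx

/-- **Lemma 2.10(1)**, elementwise for `ca`: if `x ∈ ca(R)` then `x/1 ∈ ca(U⁻¹R)` (noetherian `R`).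
[cite: IyengarTakahashi2014, Lemma 2.10(1)] -/
theorem algebraMap_mem_cohomologyAnnihilator [IsNoetherianRing R] {x : R}
    (hx : x ∈ cohomologyAnnihilator R) :
    algebraMap R (Localization U) x ∈ cohomologyAnnihilator (Localization U) :=
  have ⟨n, hn⟩ := mem_cohomologyAnnihilator_iff.mp hx
  mem_cohomologyAnnihilator_iff.mpr ⟨n, algebraMap_mem_cohomologyAnnihilatorOfDegree U hn⟩

/-- **Lemma 2.10(1)**: `U⁻¹ ca(R) ⊆ ca(U⁻¹R)` (noetherian `R`).
[cite: IyengarTakahashi2014, Lemma 2.10(1)] -/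
theorem map_cohomologyAnnihilator_le [IsNoetherianRing R] :
    (cohomologyAnnihilator R).map (algebraMap R (Localization U)) ≤ cohomologyAnnihilator _ :=
  Ideal.map_le_iff_le_comap.mpr fun _ hx => algebraMap_mem_cohomologyAnnihilator U hx

/-! ## Invariance under ring isomorphisms -/

section RingEquiv

variable {S : Type u} [CommRing S] (e : R ≃+* S)

/-- Restriction of scalars along `e : R ≃+* S` sends the homothety `e x • 𝟙` to the homothety
`x • 𝟙`. [folklore] -/
theorem restrictScalars_map_smul_id (M' : ModuleCat.{u} S) (x : R) :
    (ModuleCat.restrictScalars.{u} e.toRingHom).map (e x • 𝟙 M') =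
      x • 𝟙 ((ModuleCat.restrictScalars.{u} e.toRingHom).obj M') := by
  ext m
  rfl

/-- A finitely generated `S`-module is finitely generated as an `R`-module by restriction of
scalars (`Module.compHom`) along a ring isomorphism `e : R ≃+* S`. [folklore] -/
theorem finite_compHom_of_ringEquiv (N : Type u) [AddCommGroup N] [Module S N] [Module.Finite S N] :
    letI := Module.compHom N e.toRingHom
    Module.Finite R N := by
  letI := Module.compHom N e.toRingHom
  obtain ⟨s, hs⟩ := Module.Finite.fg_top (R := S) (M := N)
  let P : Submodule S N :=
    { carrier := (Submodule.span R (s : Set N) : Set N)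
      add_mem' := fun ha hb => Submodule.add_mem _ ha hb
      zero_mem' := Submodule.zero_mem _
      smul_mem' := fun c y hy => by
        have : c • y = (e.symm c) • y := by
          change c • y = e.toRingHom (e.symm c) • y
          simp
        rw [this]
        exact Submodule.smul_mem _ _ hy }
  have hP : (⊤ : Submodule S N) ≤ P := by
    rw [← hs, Submodule.span_le]
    exact Submodule.subset_span
  exact ⟨⟨s, eq_top_iff.mpr fun m _ => hP (Submodule.mem_top : m ∈ (⊤ : Submodule S N))⟩⟩

/-- `ca` is invariant under ring isomorphisms, elementwise: `x ∈ caⁿ(R) → e x ∈ caⁿ(S)`.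
Proof: restriction of scalars `G` along `e` is an exact equivalence `ModuleCat S ⥤ ModuleCat R`,
so `Ext_S(M', N') → Ext_R(G M', G N')` is bijective (Mathlib), and it maps `(e x) • e'` to
`x • G(e') = 0`. [folklore] -/
theorem ringEquiv_apply_mem_cohomologyAnnihilatorOfDegree {n : ℕ} {x : R}
    (hx : x ∈ cohomologyAnnihilatorOfDegree R n) :
    e x ∈ cohomologyAnnihilatorOfDegree S n := by
  rw [mem_cohomologyAnnihilatorOfDegree_iff]
  intro i hi M' N' hM' hN' e'
  have hinj := ((ModuleCat.restrictScalars.{u} e.toRingHom).mapExt_bijective_of_preservesProjectiveObjects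
    M' N' i).1
  haveI : Module.Finite R ((ModuleCat.restrictScalars.{u} e.toRingHom).obj M') :=
    finite_compHom_of_ringEquiv e M'
  haveI : Module.Finite R ((ModuleCat.restrictScalars.{u} e.toRingHom).obj N') :=
    finite_compHom_of_ringEquiv e N'
  apply hinj
  rw [map_zero, Functor.mapExtAddHom_apply, Ext.smul_eq_comp_mk₀, Ext.mapExactFunctor_comp,
    Ext.mapExactFunctor_mk₀, restrictScalars_map_smul_id, ← Ext.smul_eq_comp_mk₀]
  exact smul_eq_zero_of_mem_cohomologyAnnihilatorOfDegree hx hi _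

/-- `ca` is invariant under ring isomorphisms: `e(caⁿ(R)) = caⁿ(S)`. [folklore] -/
theorem map_ringEquiv_cohomologyAnnihilatorOfDegree (n : ℕ) :
    (cohomologyAnnihilatorOfDegree R n).map (e : R →+* S) = cohomologyAnnihilatorOfDegree S n := by
  refine le_antisymm (Ideal.map_le_iff_le_comap.mpr fun x hx =>
    ringEquiv_apply_mem_cohomologyAnnihilatorOfDegree e hx) fun y hy => ?_
  rw [← e.apply_symm_apply y]
  exact Ideal.mem_map_of_mem _ (ringEquiv_apply_mem_cohomologyAnnihilatorOfDegree e.symm hy)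

/-- `ca` is invariant under ring isomorphisms: `e(ca(R)) = ca(S)`. [folklore] -/
theorem map_ringEquiv_cohomologyAnnihilator :
    (cohomologyAnnihilator R).map (e : R →+* S) = cohomologyAnnihilator S := by
  simp only [cohomologyAnnihilator, Ideal.map_iSup, map_ringEquiv_cohomologyAnnihilatorOfDegree]

end RingEquiv

/-! ## Lemma 2.10(1) for an arbitrary localisation `IsLocalization U R'` -/

/-- **Lemma 2.10(1)** for any localisation `R'` of `R` at `U` (`IsLocalization U R'`):
`caⁿ(R) R' ⊆ caⁿ(R')` — transported from `Localization U` along the canonical isomorphism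
`Localization U ≃ₐ[R] R'`. [cite: IyengarTakahashi2014, Lemma 2.10(1)] -/
theorem map_cohomologyAnnihilatorOfDegree_le_of_isLocalization [IsNoetherianRing R]
    (R' : Type u) [CommRing R'] [Algebra R R'] [IsLocalization U R'] (n : ℕ) :
    (cohomologyAnnihilatorOfDegree R n).map (algebraMap R R') ≤
      cohomologyAnnihilatorOfDegree R' n := by
  let h := IsLocalization.algEquiv U (Localization U) R'
  have hcomp : algebraMap R R' =
      (h.toRingEquiv : Localization U →+* R').comp (algebraMap R (Localization U)) := by
    ext x
    simp [h]
  rw [hcomp, ← Ideal.map_map]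
  refine (Ideal.map_mono (map_cohomologyAnnihilatorOfDegree_le U n)).trans ?_
  rw [map_ringEquiv_cohomologyAnnihilatorOfDegree h.toRingEquiv n]

/-- **Lemma 2.10(1)** for any localisation `R'` of `R` at `U` (`IsLocalization U R'`):
`ca(R) R' ⊆ ca(R')`. [cite: IyengarTakahashi2014, Lemma 2.10(1)] -/
theorem map_cohomologyAnnihilator_le_of_isLocalization [IsNoetherianRing R]
    (R' : Type u) [CommRing R'] [Algebra R R'] [IsLocalization U R'] :
    (cohomologyAnnihilator R).map (algebraMap R R') ≤ cohomologyAnnihilator R' := by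
  let h := IsLocalization.algEquiv U (Localization U) R'
  have hcomp : algebraMap R R' =
      (h.toRingEquiv : Localization U →+* R').comp (algebraMap R (Localization U)) := by
    ext x
    simp [h]
  rw [hcomp, ← Ideal.map_map]
  refine (Ideal.map_mono (map_cohomologyAnnihilator_le U)).trans ?_
  rw [map_ringEquiv_cohomologyAnnihilator h.toRingEquiv]

/-- **Lemma 2.10(1)**, elementwise, for any localisation `R'` of `R` at `U`: `x ∈ ca(R)` implies
`algebraMap R R' x ∈ ca(R')`. [cite: IyengarTakahashi2014, Lemma 2.10(1)] -/
theorem algebraMap_mem_cohomologyAnnihilator_of_isLocalization [IsNoetherianRing R]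
    (R' : Type u) [CommRing R'] [Algebra R R'] [IsLocalization U R'] {x : R}
    (hx : x ∈ cohomologyAnnihilator R) : algebraMap R R' x ∈ cohomologyAnnihilator R' :=
  map_cohomologyAnnihilator_le_of_isLocalization U R' (Ideal.mem_map_of_mem _ hx)

end Literature.RingTheory.CohomologyAnnihilator
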